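import Literature.Analysis.FluidPDE.ForcedFourierMildSolution
import Literature.Analysis.FluidPDE.TaoH1FourierMildClassical
import HarnessLib

/-!
# Sobolev bounds and `L²`-continuity of the solution synthesized from a FORCED Fourier-side
# `H¹`-mild solution of Sobolev class (classical half of the forced engine, file 3)

Forced twin of `TaoH1FourierMildClassical.lean` (T. Tao, Anal. PDE 6 (2013) = arXiv:1108.1165,
Thm. 5.4 = arXiv Thm. 31 (p. 18), (iv) with (i): "`∂ₜʲ u, ∂ₜʲ p ∈ L^∞_t H^k([0, T] × ℝ³)` for all
`j, k ≥ 0`" and "`u ∈ C⁰_t H¹_x`" for the `H¹` mild solution `(u, p, u₀, f, T)` with Schwartz data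
— Tao states and proves Thm. 5.4 WITH the forcing term). For `v` with
`IsSobolevMildForced (4π²ν) T a b v` (`ForcedFourierDuhamelDefs.lean`, seat `ns-blowup-lean2`),
`a` of Sobolev class, a PROJECTED force `b` carrying a derivative tower `B` of square-dominated
families and conjugation symmetric (real physical force), and the fields
`u(t) = synthVel (v t)`, `p(t) = Re 𝓕 presSymbol (v t) (v t)`, `g(t) = synthVel (b t)` of
`ForcedFourierMildSolution.lean`:

* `IsSobolevMildForced.hasBoundedSobolevNormsOn_u` — `u ∈ L^∞_t H^k_x` for all `k` (verbatim: the
  envelopes of `ForcedFourierMildFamily`);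
* `IsSobolevMildForced.hasBoundedSobolevNormsOn_timeDerivWithin` — `∂ₜu ∈ L^∞_t H^k_x([0, T])`:
  the one-sided time derivative is the synthesis of `-c‖ξ‖² v − N(v, v) + b`, whose envelopes are
  those of `v` two orders up, the pointwise decay of the nonlinearity, and the force's own
  square-integrable envelopes (`exists_env_force`);
* `IsSobolevMildForced.sobolev_p` — `p ∈ L^∞_t H^k_x` (unchanged: projected force);
* `hasBoundedSobolevNormsOn_force` — the synthesized force `g ∈ L^∞_t H^k_x([0, T])`;
* `IsSobolevMildForced.continuousInLpOn_u` — `u ∈ C([0, T]; L²)`;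
* the PACKAGE `IsSobolevMildForced.classical`: for `ν > 0`, `T > 0`, there is a pressure `p` with
  `IsClassicalNSSolutionOn (Icc 0 T) ν g u p`, `u, ∂ₜu ∈ L^∞_t H^k_x`, `p ∈ L^∞_t H^k_x`,
  `u ∈ C([0,T]; L²)` — the shape of the conclusion of the named fact
  `tao2011_smooth_local_existence_forced` (`TaoH1LocalExistenceForced.lean`) on the Fourier side,
  for the projected force. (The assembly — physical force `f` ↦ `b = (P f)^`, datum `u₀ ↦ a`, the
  existence half, and the gauge change `p ↦ p − φ`, `∇φ = f − P f` — is the remaining file of the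
  port; it discharges F2 and hence `LocalContinuationAt k` of route `PalasekTowerBreakdown`,
  child crux `HeredityAtOne`, via ecbridge-1's `localContinuationAt_of_forced_local_existence`.)

Theorems only; no definition, no named fact (net Literature debt 0).

## Mathlib / tree search

Reused: `lintegral_sq_norm_iteratedFDeriv_synthVel_le_of_env`, `contDiff_synthVel_of_moments`,
`lintegral_enorm_sq_lt_top_of_memLp` (`TaoH1FourierMildClassical`),
`lintegral_sq_norm_iteratedFDeriv_re_fourier_le` (`NSFourierTaoClass`), `lintegral_sq_fourier_eq`,
`enorm_reVec_sq_le`, `eLpNorm_two_eq_sqrt` (`NSLocalRegular`), `nonlin_conj_symm`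
(`NSFourierBilinear`), `IsDomFamily.dom`/`dom_L1` (`NSRegFourierFamily`), the `IsSobolevMildForced`
API of `ForcedFourierMildFamily`/`ForcedFourierMildSolution`. `lean search
'IsSobolevMildForced.hasBoundedSobolev'`: no hits before this file.

## References

* T. Tao, arXiv:1108.1165 = Anal. PDE 6 (2013), Thm. 5.4 = arXiv Thm. 31 (p. 18), (i), (iv) and
  the note closing the proof of (iv). [Tao2011]
* J. Leray, Acta Math. 63 (1934), §19, (1.17)–(1.19). [Leray1934]
-/

noncomputable section

open MeasureTheory Real Set Filter Function Complex FourierTransform VectorFourier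
  InnerProductSpace
open scoped FourierTransform RealInnerProductSpace ENNReal NNReal ContDiff ComplexConjugate
open _root_.Topology

namespace Literature.Analysis.FluidPDE

namespace FourierNS

/-! ### The solution: `u`, `∂ₜu`, `p`, `g` in `L^∞_t H^k_x`, and `u ∈ C([0, T]; L²)` -/

section Solution

variable {c T : ℝ} {a : EuclideanSpace ℝ (Fin 3) → Fin 3 → ℂ}
  {b : ℝ → EuclideanSpace ℝ (Fin 3) → Fin 3 → ℂ} {B : ℕ → ℝ → EuclideanSpace ℝ (Fin 3) → Fin 3 → ℂ}
  {v : ℝ → EuclideanSpace ℝ (Fin 3) → Fin 3 → ℂ}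

open ClayDatum (reVec reVec_apply)

/-- **`u ∈ L^∞_t H^k_x` for every `k`** along a forced mild solution (Tao 2011, Thm. 5.4 (iv),
`j = 0`, with force): the Sobolev norms of `u(t) = synthVel (v t)` are bounded uniformly in time,
by the Plancherel bound with the time-uniform square-integrable envelopes of `v`.
[cite: Tao2011, Thm. 5.4 (iv) (arXiv Thm. 31)] -/
theorem IsSobolevMildForced.hasBoundedSobolevNormsOn_u (h : IsSobolevMildForced c T a b v)
    (hc : 0 ≤ c) (ha : IsSobolevFourierDatum a) (S : Set ℝ) :
    HasBoundedSobolevNormsOn S (fun t => synthVel (v t)) := by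
  intro n
  have hdom : ∀ l : Fin 3, ∃ G : EuclideanSpace ℝ (Fin 3) → ℝ, MemLp G 2 volume ∧
      ∀ t ξ, (1 + ‖ξ‖) ^ n * ‖v t ξ l‖ ≤ G ξ := fun l => h.exists_dom hc ha n l
  choose G hG hle using hdom
  set C : ℝ≥0∞ := ENNReal.ofReal (3 ^ (n + 1) * (2 * π) ^ (2 * n)) * ∑ l, ∫⁻ ξ, ‖G l ξ‖ₑ ^ 2
    with hCdef
  have hC : C < ⊤ := ENNReal.mul_lt_top ENNReal.ofReal_lt_top
    (ENNReal.sum_lt_top.2 fun l _ => lintegral_enorm_sq_lt_top_of_memLp (hG l))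
  refine ⟨C.toNNReal, fun t _ => ?_⟩
  rw [ENNReal.coe_toNNReal hC.ne]
  refine lintegral_sq_norm_iteratedFDeriv_synthVel_le_of_env (v t) (fun i => h.aesm_apply t i)
    (fun k i => h.integrable_pow_mul_norm hc ha k t i) (fun ξ l => h.conjSymm t ξ l) n hG
    fun ξ i => ?_
  calc ‖ξ‖ ^ n * ‖v t ξ i‖ ≤ (1 + ‖ξ‖) ^ n * ‖v t ξ i‖ := by
        gcongr; linarith [norm_nonneg ξ]
    _ ≤ G i ξ := hle i t ξ

/-! #### The force: moments and envelopes -/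

/-- Moments of every order of the force slices are integrable on `[0, T]`
(`‖ξ‖ᵏ ‖b(t, ξ)ₗ‖ ≤ (1+‖ξ‖)ᵏ ‖b(t, ξ)ₗ‖ ≤ g(ξ)`, `g ∈ L¹` from the square domination).
[cite: Tao2011, Thm. 5.4 (iv) (arXiv Thm. 31)] -/
theorem integrable_pow_mul_norm_force (hT : 0 ≤ T) (hB0 : B 0 = b)
    (hB : ∀ n l, IsDomFamily T n (fun k t ξ => B k t ξ l)) {t : ℝ} (ht : t ∈ Icc 0 T) (k : ℕ)
    (l : Fin 3) :
    Integrable fun ξ : EuclideanSpace ℝ (Fin 3) => ‖ξ‖ ^ k * ‖b t ξ l‖ := by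
  obtain ⟨g, hg, -, hle⟩ := (hB 0 l).dom_L1 hT (k := 0) le_rfl k
  have hmeas : AEStronglyMeasurable (fun ξ => b t ξ l) volume := by
    have := (hB 0 l).meas 0 le_rfl t ht
    simpa only [hB0] using this
  refine hg.mono' ((continuous_norm.pow k).aestronglyMeasurable.mul hmeas.norm)
    (Eventually.of_forall fun ξ => ?_)
  rw [Real.norm_of_nonneg (by positivity)]
  have h1 := hle t ht ξ
  simp only [hB0] at h1
  calc ‖ξ‖ ^ k * ‖b t ξ l‖ ≤ (1 + ‖ξ‖) ^ k * ‖b t ξ l‖ := by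
        gcongr; linarith [norm_nonneg ξ]
    _ ≤ g ξ := h1

/-- **Square-integrable envelopes of the force of every order**, uniformly on `[0, T]`:
`‖ξ‖ⁿ ‖b(t, ξ)ₗ‖ ≤ G(ξ)`, `G ∈ L²`. [cite: Tao2011, Thm. 5.4 (iv) (arXiv Thm. 31)] -/
theorem exists_env_force (hB0 : B 0 = b) (hB : ∀ n l, IsDomFamily T n (fun k t ξ => B k t ξ l))
    (n : ℕ) (l : Fin 3) :
    ∃ G : EuclideanSpace ℝ (Fin 3) → ℝ, MemLp G 2 volume ∧ ∀ t ∈ Icc 0 T, ∀ ξ,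
      ‖ξ‖ ^ n * ‖b t ξ l‖ ≤ G ξ := by
  obtain ⟨G, hG, hle⟩ := (hB 0 l).dom 0 le_rfl n
  refine ⟨G, hG, fun t ht ξ => ?_⟩
  have h1 := hle t ht ξ
  simp only [hB0] at h1
  calc ‖ξ‖ ^ n * ‖b t ξ l‖ ≤ (1 + ‖ξ‖) ^ n * ‖b t ξ l‖ := by
        gcongr; linarith [norm_nonneg ξ]
    _ ≤ G ξ := h1

/-- Measurability of the force slices on `[0, T]`. [cite: Tao2011, Thm. 5.4 (iv) (arXiv Thm. 31)] -/
theorem aesm_force (hB0 : B 0 = b) (hB : ∀ n l, IsDomFamily T n (fun k t ξ => B k t ξ l))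
    {t : ℝ} (ht : t ∈ Icc 0 T) (l : Fin 3) :
    AEStronglyMeasurable (fun ξ => b t ξ l) volume := by
  have := (hB 0 l).meas 0 le_rfl t ht
  simpa only [hB0] using this

/-- **The synthesized force `g(t) = synthVel (b t)` is in `L^∞_t H^k_x([0, T])` for every `k`**
(Plancherel bound with the force's envelopes; conjugation symmetry = reality of `g`).
[cite: Tao2011, Thm. 5.4 (iv) (arXiv Thm. 31)] -/
theorem hasBoundedSobolevNormsOn_force (hT : 0 ≤ T) (hB0 : B 0 = b)
    (hB : ∀ n l, IsDomFamily T n (fun k t ξ => B k t ξ l))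
    (hbc : ∀ t ∈ Icc 0 T, ∀ ξ l, b t (-ξ) l = conj (b t ξ l)) :
    HasBoundedSobolevNormsOn (Icc 0 T) (fun t => synthVel (b t)) := by
  intro n
  have hdom := fun l : Fin 3 => exists_env_force hB0 hB n l
  choose G hG hle using hdom
  set C : ℝ≥0∞ := ENNReal.ofReal (3 ^ (n + 1) * (2 * π) ^ (2 * n)) * ∑ l, ∫⁻ ξ, ‖G l ξ‖ₑ ^ 2
    with hCdef
  have hC : C < ⊤ := ENNReal.mul_lt_top ENNReal.ofReal_lt_top
    (ENNReal.sum_lt_top.2 fun l _ => lintegral_enorm_sq_lt_top_of_memLp (hG l))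
  refine ⟨C.toNNReal, fun t ht => ?_⟩
  rw [ENNReal.coe_toNNReal hC.ne]
  exact lintegral_sq_norm_iteratedFDeriv_synthVel_le_of_env (b t) (fun i => aesm_force hB0 hB ht i)
    (fun k i => integrable_pow_mul_norm_force hT hB0 hB ht k i) (fun ξ l => hbc t ht ξ l) n hG
    fun ξ i => hle i t ht ξ

/-! #### The time derivative -/

/-- The one-sided time derivative of `u` within `[0, T]` along a forced mild solution is the
synthesis of the symbol `-c‖ξ‖² vₗ(t) − N(v(t), v(t))ₗ + bₗ(t)`. [cite: Tao2011, Thm. 5.4 (iv) (arXiv Thm. 31), (8)] -/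
theorem IsSobolevMildForced.timeDerivWithin_u_eq_synthVel (h : IsSobolevMildForced c T a b v)
    (hc : 0 ≤ c) (hT : 0 < T) (ha : IsSobolevFourierDatum a) (hB0 : B 0 = b)
    (hB : ∀ n l, IsDomFamily T n (fun k t ξ => B k t ξ l)) {t : ℝ} (ht : t ∈ Icc 0 T) :
    timeDerivWithin (Icc 0 T) (fun s => synthVel (v s)) t = synthVel fun ξ l =>
      -((c * ‖ξ‖ ^ 2 : ℝ) : ℂ) * v t ξ l - nonlin (v t) (v t) ξ l + b t ξ l := by
  funext x
  rw [h.timeDerivWithin_u hc hT ha hB0 hB x ht]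
  rfl

/-- The forced time-derivative symbol is conjugation symmetric (reality of `∂ₜu`), for a
conjugation-symmetric force. [cite: Tao2011, Thm. 5.4 (iv) (arXiv Thm. 31)] -/
theorem IsSobolevMildForced.dtSymbol_conj (h : IsSobolevMildForced c T a b v) {t : ℝ}
    (hbc : ∀ ξ l, b t (-ξ) l = conj (b t ξ l)) (ξ : EuclideanSpace ℝ (Fin 3)) (l : Fin 3) :
    (-((c * ‖-ξ‖ ^ 2 : ℝ) : ℂ) * v t (-ξ) l - nonlin (v t) (v t) (-ξ) l + b t (-ξ) l) =
      conj (-((c * ‖ξ‖ ^ 2 : ℝ) : ℂ) * v t ξ l - nonlin (v t) (v t) ξ l + b t ξ l) := by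
  rw [norm_neg, h.conjSymm t ξ l, nonlin_conj_symm (h.conjSymm t) (h.conjSymm t) ξ l, hbc ξ l,
    map_add, map_sub, map_mul, map_neg, Complex.conj_ofReal]

/-- Moments of the forced time-derivative symbol on `[0, T]` are integrable. [cite: Tao2011, Thm. 5.4 (iv) (arXiv Thm. 31)] -/
theorem IsSobolevMildForced.integrable_pow_mul_norm_dtSymbol (h : IsSobolevMildForced c T a b v)
    (hc : 0 ≤ c) (hT : 0 < T) (ha : IsSobolevFourierDatum a) (hB0 : B 0 = b)
    (hB : ∀ n l, IsDomFamily T n (fun k t ξ => B k t ξ l)) {t : ℝ} (ht : t ∈ Icc 0 T) (k : ℕ)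
    (l : Fin 3) :
    Integrable fun ξ : EuclideanSpace ℝ (Fin 3) =>
      ‖ξ‖ ^ k * ‖-((c * ‖ξ‖ ^ 2 : ℝ) : ℂ) * v t ξ l - nonlin (v t) (v t) ξ l + b t ξ l‖ := by
  obtain ⟨C, hC⟩ := h.hasDecay_nonlin hc hT ha hB0 hB (k + (Fintype.card (Fin 3) + 1)) l
  have hN := (hC t ht).1.integrable_pow_mul_norm (n := k)
    (finrank_lt_of_card_lt (Nat.lt_succ_self _)) (hC t ht).2
  have hv := (h.integrable_pow_mul_norm hc ha (k + 2) t l).const_mul c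
  have hb := integrable_pow_mul_norm_force hT.le hB0 hB ht k l
  have hmeas : AEStronglyMeasurable (fun ξ : EuclideanSpace ℝ (Fin 3) =>
      -((c * ‖ξ‖ ^ 2 : ℝ) : ℂ) * v t ξ l - nonlin (v t) (v t) ξ l + b t ξ l) volume :=
    (((Continuous.aestronglyMeasurable (by fun_prop)).mul (h.aesm_apply t l)).sub (hC t ht).2).add
      (aesm_force hB0 hB ht l)
  refine ((hv.add hN).add hb).mono' ((continuous_norm.pow k).aestronglyMeasurable.mul hmeas.norm)
    (Eventually.of_forall fun ξ => ?_)
  rw [Real.norm_of_nonneg (by positivity)]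
  calc ‖ξ‖ ^ k * ‖-((c * ‖ξ‖ ^ 2 : ℝ) : ℂ) * v t ξ l - nonlin (v t) (v t) ξ l + b t ξ l‖
      ≤ ‖ξ‖ ^ k * (‖-((c * ‖ξ‖ ^ 2 : ℝ) : ℂ) * v t ξ l‖ + ‖nonlin (v t) (v t) ξ l‖ + ‖b t ξ l‖) := by
        refine mul_le_mul_of_nonneg_left ?_ (by positivity)
        exact (norm_add_le _ _).trans (add_le_add (norm_sub_le _ _) le_rfl)
    _ = c * (‖ξ‖ ^ (k + 2) * ‖v t ξ l‖) + ‖ξ‖ ^ k * ‖nonlin (v t) (v t) ξ l‖ +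
          ‖ξ‖ ^ k * ‖b t ξ l‖ := by
        rw [norm_mul, norm_neg, Complex.norm_real, Real.norm_of_nonneg (by positivity), pow_add]
        ring

/-- **Square-integrable envelopes of the forced time-derivative symbol**, uniformly on `[0, T]`:
`‖ξ‖ⁿ ‖-c‖ξ‖² vₗ − Nₗ + bₗ‖ ≤ c G_{n+2} + C (1+‖ξ‖)^{-K₀} + G_b`. [cite: Tao2011, Thm. 5.4 (iv) (arXiv Thm. 31)] -/
theorem IsSobolevMildForced.exists_env_dtSymbol (h : IsSobolevMildForced c T a b v) (hc : 0 ≤ c)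
    (hT : 0 < T) (ha : IsSobolevFourierDatum a) (hB0 : B 0 = b)
    (hB : ∀ n l, IsDomFamily T n (fun k t ξ => B k t ξ l)) (n : ℕ) (l : Fin 3) :
    ∃ G : EuclideanSpace ℝ (Fin 3) → ℝ, MemLp G 2 volume ∧ ∀ t ∈ Icc 0 T, ∀ ξ,
      ‖ξ‖ ^ n * ‖-((c * ‖ξ‖ ^ 2 : ℝ) : ℂ) * v t ξ l - nonlin (v t) (v t) ξ l + b t ξ l‖ ≤ G ξ := by
  set K₀ := Fintype.card (Fin 3) + 1 with hK₀
  obtain ⟨G₂, hG₂, hle₂⟩ := h.exists_dom hc ha (n + 2) l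
  obtain ⟨C, hC⟩ := h.hasDecay_nonlin hc hT ha hB0 hB (n + K₀) l
  obtain ⟨Gb, hGb, hleb⟩ := exists_env_force hB0 hB n l
  refine ⟨fun ξ => c * G₂ ξ + C * ((1 + ‖ξ‖) ^ K₀)⁻¹ + Gb ξ, ?_, fun t ht ξ => ?_⟩
  · exact ((hG₂.const_mul c).add ((memLp_inv_one_add_norm_pow_two (ι := Fin 3)).const_mul C)).add hGb
  · have hN : ‖ξ‖ ^ n * ‖nonlin (v t) (v t) ξ l‖ ≤ C * ((1 + ‖ξ‖) ^ K₀)⁻¹ :=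
      ((hC t ht).1).pow_mul_norm_le (n := n) (K := K₀) ξ
    have hv : ‖ξ‖ ^ (n + 2) * ‖v t ξ l‖ ≤ G₂ ξ := by
      calc ‖ξ‖ ^ (n + 2) * ‖v t ξ l‖ ≤ (1 + ‖ξ‖) ^ (n + 2) * ‖v t ξ l‖ := by
            gcongr; linarith [norm_nonneg ξ]
        _ ≤ G₂ ξ := hle₂ t ξ
    have hb : ‖ξ‖ ^ n * ‖b t ξ l‖ ≤ Gb ξ := hleb t ht ξ
    calc ‖ξ‖ ^ n * ‖-((c * ‖ξ‖ ^ 2 : ℝ) : ℂ) * v t ξ l - nonlin (v t) (v t) ξ l + b t ξ l‖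
        ≤ ‖ξ‖ ^ n * (‖-((c * ‖ξ‖ ^ 2 : ℝ) : ℂ) * v t ξ l‖ + ‖nonlin (v t) (v t) ξ l‖ +
            ‖b t ξ l‖) := by
          refine mul_le_mul_of_nonneg_left ?_ (by positivity)
          exact (norm_add_le _ _).trans (add_le_add (norm_sub_le _ _) le_rfl)
      _ = c * (‖ξ‖ ^ (n + 2) * ‖v t ξ l‖) + ‖ξ‖ ^ n * ‖nonlin (v t) (v t) ξ l‖ +
            ‖ξ‖ ^ n * ‖b t ξ l‖ := by
          rw [norm_mul, norm_neg, Complex.norm_real, Real.norm_of_nonneg (by positivity), pow_add]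
          ring
      _ ≤ c * G₂ ξ + C * ((1 + ‖ξ‖) ^ K₀)⁻¹ + Gb ξ :=
          add_le_add (add_le_add (mul_le_mul_of_nonneg_left hv hc) hN) hb

/-- **`∂ₜu ∈ L^∞_t H^k_x([0, T] × ℝ³)` for every `k`** along a forced mild solution with a
conjugation-symmetric force (Tao 2011, Thm. 5.4 (iv), `j = 1`, with force).
[cite: Tao2011, Thm. 5.4 (iv) (arXiv Thm. 31)] -/
theorem IsSobolevMildForced.hasBoundedSobolevNormsOn_timeDerivWithin
    (h : IsSobolevMildForced c T a b v) (hc : 0 ≤ c) (hT : 0 < T) (ha : IsSobolevFourierDatum a)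
    (hB0 : B 0 = b) (hB : ∀ n l, IsDomFamily T n (fun k t ξ => B k t ξ l))
    (hbc : ∀ t ∈ Icc 0 T, ∀ ξ l, b t (-ξ) l = conj (b t ξ l)) :
    HasBoundedSobolevNormsOn (Icc 0 T) (timeDerivWithin (Icc 0 T) (fun s => synthVel (v s))) := by
  intro n
  have hdom := fun l : Fin 3 => h.exists_env_dtSymbol hc hT ha hB0 hB n l
  choose G hG hle using hdom
  set C : ℝ≥0∞ := ENNReal.ofReal (3 ^ (n + 1) * (2 * π) ^ (2 * n)) * ∑ l, ∫⁻ ξ, ‖G l ξ‖ₑ ^ 2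
    with hCdef
  have hC : C < ⊤ := ENNReal.mul_lt_top ENNReal.ofReal_lt_top
    (ENNReal.sum_lt_top.2 fun l _ => lintegral_enorm_sq_lt_top_of_memLp (hG l))
  refine ⟨C.toNNReal, fun t ht => ?_⟩
  rw [ENNReal.coe_toNNReal hC.ne, h.timeDerivWithin_u_eq_synthVel hc hT ha hB0 hB ht]
  set V₁ : EuclideanSpace ℝ (Fin 3) → Fin 3 → ℂ := fun ξ l =>
    -((c * ‖ξ‖ ^ 2 : ℝ) : ℂ) * v t ξ l - nonlin (v t) (v t) ξ l + b t ξ l with hV₁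
  have hmeas : ∀ i, AEStronglyMeasurable (fun ξ => V₁ ξ i) volume := fun i => by
    obtain ⟨C', hC'⟩ := h.hasDecay_nonlin hc hT ha hB0 hB 0 i
    exact (((Continuous.aestronglyMeasurable (by fun_prop)).mul (h.aesm_apply t i)).sub
      (hC' t ht).2).add (aesm_force hB0 hB ht i)
  exact lintegral_sq_norm_iteratedFDeriv_synthVel_le_of_env V₁ hmeas
    (fun k i => h.integrable_pow_mul_norm_dtSymbol hc hT ha hB0 hB ht k i)
    (fun ξ l => h.dtSymbol_conj (hbc t ht) ξ l) n hG (fun ξ i => hle i t ht ξ)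

/-! #### The pressure -/

/-- **`p ∈ L^∞_t H^k_x([0, T] × ℝ³)` for every `k`** along a forced mild solution (Tao 2011,
Thm. 5.4 (iv), `j = 0` for the pressure; projected force, Riesz pressure (9)): `p = Re 𝓕 q` with
`q(t) = presSymbol (v t) (v t)` measurable with every polynomial decay uniformly on `[0, T]`.
[cite: Tao2011, Thm. 5.4 (iv) (arXiv Thm. 31), (9)] -/
theorem IsSobolevMildForced.sobolev_p (h : IsSobolevMildForced c T a b v) (hc : 0 ≤ c)
    (hT : 0 < T) (ha : IsSobolevFourierDatum a) (hB0 : B 0 = b)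
    (hB : ∀ n l, IsDomFamily T n (fun k t ξ => B k t ξ l)) : ∀ n : ℕ, ∃ C : ℝ≥0, ∀ t ∈ Icc 0 T,
      ∫⁻ x, ‖iteratedFDeriv ℝ n (fun y => (𝓕 (presSymbol (v t) (v t)) y).re) x‖ₑ ^ 2 ≤ C := by
  intro n
  obtain ⟨C₀, hC₀⟩ := h.hasDecay_presSymbol hc hT ha hB0 hB (Fintype.card (Fin 3) + 1 + n)
  set C : ℝ≥0∞ := ENNReal.ofReal ((Fintype.card (Fin 3) : ℝ) ^ n) *
    (Fintype.card (Fin n → Fin 3) * ENNReal.ofReal (((2 * π) ^ n * C₀) ^ 2 *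
      weightMass (EuclideanSpace ℝ (Fin 3)) (Fintype.card (Fin 3) + 1))) with hCdef
  have hC : C < ⊤ := ENNReal.mul_lt_top ENNReal.ofReal_lt_top
    (ENNReal.mul_lt_top (ENNReal.natCast_lt_top _) ENNReal.ofReal_lt_top)
  refine ⟨C.toNNReal, fun t ht => ?_⟩
  rw [ENNReal.coe_toNNReal hC.ne]
  have hdec : ∀ K : ℕ, ∃ C', HasDecay K C' (presSymbol (v t) (v t)) := fun K => by
    obtain ⟨C', hC'⟩ := h.hasDecay_presSymbol hc hT ha hB0 hB K
    exact ⟨C', (hC' t ht).1⟩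
  exact lintegral_sq_norm_iteratedFDeriv_re_fourier_le (hC₀ t ht).2 hdec n (hC₀ t ht).1

/-! #### Continuity in `L²` (verbatim) -/

/-- The complex velocity components of a forced mild solution are in `L²` with
`∫ ‖𝓕 vₗ(t)‖² = ∫ ‖vₗ(t)‖²`. [cite: Tao2011, Thm. 5.4 (i) (arXiv Thm. 31)] -/
theorem IsSobolevMildForced.lintegral_sq_fourier_apply_eq (h : IsSobolevMildForced c T a b v)
    (hc : 0 ≤ c) (ha : IsSobolevFourierDatum a) (t : ℝ) (l : Fin 3) :
    ∫⁻ x, ‖𝓕 (fun ξ => v t ξ l) x‖ₑ ^ 2 = ∫⁻ ξ, ‖v t ξ l‖ₑ ^ 2 :=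
  lintegral_sq_fourier_eq (h.integrable_apply hc ha t l) (h.memLp_apply hc ha t l)

/-- Pointwise: `‖u t x − u t₀ x‖² ≤ ∑ₗ ‖𝓕 (vₗ t − vₗ t₀) x‖²` for a forced mild solution.
[cite: Tao2011, Thm. 5.4 (i) (arXiv Thm. 31)] -/
theorem IsSobolevMildForced.enorm_u_sub_sq_le (h : IsSobolevMildForced c T a b v) (hc : 0 ≤ c)
    (ha : IsSobolevFourierDatum a) (t t₀ : ℝ) (x : EuclideanSpace ℝ (Fin 3)) :
    ‖synthVel (v t) x - synthVel (v t₀) x‖ₑ ^ 2 ≤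
      ∑ l, ‖𝓕 (fun ξ => v t ξ l - v t₀ ξ l) x‖ₑ ^ 2 := by
  have hsub : synthVel (v t) x - synthVel (v t₀) x =
      reVec (fun l => 𝓕 (fun ξ => v t ξ l - v t₀ ξ l) x) := by
    have h1 : synthVel (v t) x - synthVel (v t₀) x =
        reVec ((fun l => 𝓕 (fun ξ => v t ξ l) x) - fun l => 𝓕 (fun ξ => v t₀ ξ l) x) := by
      rw [map_sub]; rfl
    rw [h1]
    congr 1
    funext l
    rw [Pi.sub_apply, ← fourier_sub' (h.integrable_apply hc ha t l) (h.integrable_apply hc ha t₀ l)]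
    rfl
  rw [hsub]
  exact enorm_reVec_sq_le _

/-- **`∫ ‖u(t) − u(t₀)‖² → 0` as `t → t₀`** for a forced mild solution (Plancherel componentwise
and the `L²`-continuity of the components of `v`). [cite: Tao2011, Thm. 5.4 (i) (arXiv Thm. 31)] -/
theorem IsSobolevMildForced.tendsto_lintegral_u_sub (h : IsSobolevMildForced c T a b v)
    (hc : 0 ≤ c) (ha : IsSobolevFourierDatum a) (t₀ : ℝ) :
    Tendsto (fun t => ∫⁻ x, ‖synthVel (v t) x - synthVel (v t₀) x‖ₑ ^ 2) (𝓝 t₀) (𝓝 0) := by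
  have hvj : ∀ t j, Integrable fun ξ => v t ξ j := fun t j => h.integrable_apply hc ha t j
  have hsum : Tendsto (fun t => ∑ l, ∫⁻ x, ‖𝓕 (fun ξ => v t ξ l - v t₀ ξ l) x‖ₑ ^ 2) (𝓝 t₀)
      (𝓝 0) := by
    rw [show (0 : ℝ≥0∞) = ∑ _l : Fin 3, 0 by simp]
    refine tendsto_finsetSum _ fun l _ => ?_
    have heq : ∀ t, ∫⁻ x, ‖𝓕 (fun ξ => v t ξ l - v t₀ ξ l) x‖ₑ ^ 2 =
        eLpNorm ((v t · l) - (v t₀ · l)) 2 volume ^ 2 := fun t => by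
      have e := lintegral_sq_fourier_eq ((hvj t l).sub (hvj t₀ l))
        ((h.memLp_apply hc ha t l).sub (h.memLp_apply hc ha t₀ l))
      rw [← lintegral_enorm_sq_eq_eLpNorm_sq]
      exact e
    simp_rw [heq]
    have h2 := ENNReal.Tendsto.pow (n := 2) (h.tendsto_eLpNorm_sub hc ha l t₀)
    simpa using h2
  refine tendsto_of_tendsto_of_tendsto_of_le_of_le tendsto_const_nhds hsum (fun _ => bot_le) fun t => ?_
  calc ∫⁻ x, ‖synthVel (v t) x - synthVel (v t₀) x‖ₑ ^ 2
      ≤ ∫⁻ x, ∑ l, ‖𝓕 (fun ξ => v t ξ l - v t₀ ξ l) x‖ₑ ^ 2 :=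
        lintegral_mono (h.enorm_u_sub_sq_le hc ha t t₀)
    _ = ∑ l, ∫⁻ x, ‖𝓕 (fun ξ => v t ξ l - v t₀ ξ l) x‖ₑ ^ 2 := by
        refine lintegral_finsetSum' _ fun l _ => ?_
        exact (continuous_fourierIntegral ((hvj t l).sub (hvj t₀ l))).measurable.enorm.pow_const 2
          |>.aemeasurable

/-- **`u(t) ∈ L²`** for every `t` along a forced mild solution. [cite: Tao2011, Thm. 5.4 (i) (arXiv Thm. 31)] -/
theorem IsSobolevMildForced.memLp_u (h : IsSobolevMildForced c T a b v) (hc : 0 ≤ c)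
    (ha : IsSobolevFourierDatum a) (t : ℝ) : MemLp (synthVel (v t)) 2 volume := by
  have hcont : Continuous (synthVel (v t)) :=
    (contDiff_synthVel_of_moments (v t) fun k i => h.integrable_pow_mul_norm hc ha k t i).continuous
  refine ⟨hcont.aestronglyMeasurable, ?_⟩
  rw [eLpNorm_two_eq_sqrt]
  refine ENNReal.rpow_lt_top_of_nonneg (by norm_num) (ne_of_lt ?_)
  have hvj : ∀ j, Integrable fun ξ => v t ξ j := fun j => h.integrable_apply hc ha t j
  calc ∫⁻ x, ‖synthVel (v t) x‖ₑ ^ 2 ≤ ∫⁻ x, ∑ l, ‖𝓕 (fun ξ => v t ξ l) x‖ₑ ^ 2 :=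
        lintegral_mono fun x => enorm_reVec_sq_le _
    _ = ∑ l, ∫⁻ x, ‖𝓕 (fun ξ => v t ξ l) x‖ₑ ^ 2 := by
        refine lintegral_finsetSum' _ fun l _ => ?_
        exact (continuous_fourierIntegral (hvj l)).measurable.enorm.pow_const 2 |>.aemeasurable
    _ = ∑ l, ∫⁻ ξ, ‖v t ξ l‖ₑ ^ 2 := Finset.sum_congr rfl fun l _ =>
        h.lintegral_sq_fourier_apply_eq hc ha t l
    _ < ⊤ := by
        refine ENNReal.sum_lt_top.2 fun l _ => ?_
        rw [lintegral_enorm_sq_eq_eLpNorm_sq]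
        exact ENNReal.pow_lt_top (h.memLp_apply hc ha t l).eLpNorm_lt_top

/-- **`u ∈ C([0, T]; L²)`** along a forced mild solution (Tao 2011, Thm. 5.4 (i) with force:
`u ∈ C⁰_t H¹_x`, here the `L²` part). [cite: Tao2011, Thm. 5.4 (i) (arXiv Thm. 31)] -/
theorem IsSobolevMildForced.continuousInLpOn_u (h : IsSobolevMildForced c T a b v) (hc : 0 ≤ c)
    (ha : IsSobolevFourierDatum a) : ContinuousInLpOn (Icc 0 T) 2 (fun t => synthVel (v t)) := by
  refine ⟨fun t _ => h.memLp_u hc ha t, fun t₀ _ => ?_⟩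
  have h1 : Tendsto (fun t => eLpNorm (synthVel (v t) - synthVel (v t₀)) 2 volume) (𝓝 t₀) (𝓝 0) := by
    have h2 : ∀ t, eLpNorm (synthVel (v t) - synthVel (v t₀)) 2 volume =
        (∫⁻ x, ‖synthVel (v t) x - synthVel (v t₀) x‖ₑ ^ 2) ^ (1 / 2 : ℝ) := fun t =>
      eLpNorm_two_eq_sqrt _
    simp_rw [h2]
    have h3 := (ENNReal.continuous_rpow_const (y := (1 / 2 : ℝ))).tendsto 0
    rw [ENNReal.zero_rpow_of_pos (by norm_num)] at h3
    exact h3.comp (h.tendsto_lintegral_u_sub hc ha t₀)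
  exact h1.mono_left nhdsWithin_le_nhds

/-! #### The package -/

/-- **Tao 2011, Thm. 5.4 (iv) with (i), FORCED, Fourier side — the classical half of the forced
engine.** For `ν > 0`, `T > 0`, a datum `a` of Sobolev class, a projected force `b` with a
derivative tower `B` of square-dominated families on `[0, T]` (`B 0 = b`, `∂ₜ B_k = B_{k+1}`)
that is conjugation symmetric on `[0, T]`, and a forced Fourier-side mild solution `v`
(`IsSobolevMildForced (4π²ν) T a b v`), the synthesis `u(t) = synthVel (v t)` with the pressure
`p = Re 𝓕 presSymbol (v t) (v t)` is a classical solution of the Navier–Stokes system with force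
`g(t) = synthVel (b t)` on the closed slab `[0, T] × ℝ³`, with `u, ∂ₜu, p ∈ L^∞_t H^k_x` for every
`k` and `u ∈ C([0, T]; L²)` — "if `(u, p, u₀, f, T, 1)` is a `H¹` mild solution [with Schwartz
data], then `u` and `p` are smooth; in fact, one has `∂ₜʲu, ∂ₜʲp ∈ L^∞_t H^k([0, T] × ℝ³)`".
[cite: Tao2011, Thm. 5.4 (iv) (arXiv Thm. 31)] -/
theorem IsSobolevMildForced.classical {ν T : ℝ} (hν : 0 < ν) (hT : 0 < T)
    {a : EuclideanSpace ℝ (Fin 3) → Fin 3 → ℂ} (ha : IsSobolevFourierDatum a)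
    {b : ℝ → EuclideanSpace ℝ (Fin 3) → Fin 3 → ℂ}
    {B : ℕ → ℝ → EuclideanSpace ℝ (Fin 3) → Fin 3 → ℂ} (hB0 : B 0 = b)
    (hB : ∀ n l, IsDomFamily T n (fun k t ξ => B k t ξ l))
    (hbc : ∀ t ∈ Icc 0 T, ∀ ξ l, b t (-ξ) l = conj (b t ξ l))
    {v : ℝ → EuclideanSpace ℝ (Fin 3) → Fin 3 → ℂ} (hv : IsSobolevMildForced (4 * π ^ 2 * ν) T a b v) :
    ∃ p : ℝ → EuclideanSpace ℝ (Fin 3) → ℝ,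
      FluidPDE.IsClassicalNSSolutionOn (Icc 0 T) ν (fun t => synthVel (b t))
        (fun t => synthVel (v t)) p ∧
      HasBoundedSobolevNormsOn (Icc 0 T) (fun t => synthVel (v t)) ∧
      HasBoundedSobolevNormsOn (Icc 0 T)
        (FluidPDE.timeDerivWithin (Icc 0 T) (fun t => synthVel (v t))) ∧
      (∀ n : ℕ, ∃ C : ℝ≥0, ∀ t ∈ Icc 0 T, ∫⁻ x, ‖iteratedFDeriv ℝ n (p t) x‖ₑ ^ 2 ≤ C) ∧
      FluidPDE.ContinuousInLpOn (Icc 0 T) 2 (fun t => synthVel (v t)) := by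
  have hc : 0 ≤ 4 * π ^ 2 * ν := by positivity
  exact ⟨fun t x => (𝓕 (presSymbol (v t) (v t)) x).re,
    hv.isClassicalNSSolutionOn hν.le hT ha hB0 hB, hv.hasBoundedSobolevNormsOn_u hc ha (Icc 0 T),
    hv.hasBoundedSobolevNormsOn_timeDerivWithin hc hT ha hB0 hB hbc, hv.sobolev_p hc hT ha hB0 hB,
    hv.continuousInLpOn_u hc ha⟩

/-! #### One tower from towers of every finite order

The physical-transfer file may deliver the time derivatives of the force as a tower PER ORDER
(`∀ n, ∃ B, B 0 = b ∧ ∀ l, IsDomFamily T n (B · l)`); the package above consumes ONE tower valid at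
every order. On `[0, T]`, `T > 0`, one-sided derivatives are unique, so the members of any two such
towers agree on the slab and the diagonal `B' k := (tower of order k) k` is a single tower of every
order. -/

/-- Members of two derivative towers of the same function agree on `[0, T]` (`T > 0`: one-sided
derivatives within the slab are unique), up to the common order. [cite: Tao2011, Thm. 5.4 (iv) (arXiv Thm. 31)] -/
theorem IsDomFamily.eq_on_of_zero_eq {T : ℝ} (hT : 0 < T) {n m : ℕ}
    {W W' : ℕ → ℝ → EuclideanSpace ℝ (Fin 3) → ℂ} (hW : IsDomFamily T n W) (hW' : IsDomFamily T m W')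
    (h0 : W 0 = W' 0) : ∀ k, k ≤ n → k ≤ m → ∀ t ∈ Icc 0 T, ∀ ξ, W k t ξ = W' k t ξ := by
  intro k
  induction k with
  | zero => intro _ _ t _ ξ; rw [h0]
  | succ k ih =>
    intro hk hk' t ht ξ
    have h1 : HasDerivWithinAt (fun s => W k s ξ) (W (k + 1) t ξ) (Icc 0 T) t :=
      hW.deriv k (by omega) ξ t ht
    have h2 : HasDerivWithinAt (fun s => W' k s ξ) (W' (k + 1) t ξ) (Icc 0 T) t :=
      hW'.deriv k (by omega) ξ t ht
    have heq : ∀ s ∈ Icc 0 T, W k s ξ = W' k s ξ := fun s hs =>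
      ih (by omega) (by omega) s hs ξ
    have h2' : HasDerivWithinAt (fun s => W k s ξ) (W' (k + 1) t ξ) (Icc 0 T) t :=
      h2.congr heq (heq t ht)
    exact (uniqueDiffOn_Icc hT t ht).eq_deriv _ h1 h2'

/-- **One tower of every order from towers of each finite order.** If for every `n` the projected
force `b` has SOME tower `B⁽ⁿ⁾` of order `n` (`B⁽ⁿ⁾ 0 = b`, components square-dominated families of
order `n` on `[0, T]`), `T > 0`, then there is a single tower `B` with `B 0 = b` whose components are
square-dominated families of EVERY order (the diagonal `B k := B⁽ᵏ⁾ k`; Tao's "`∂ₜʲ f` for all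
`j`"). [cite: Tao2011, Thm. 5.4 (iv) (arXiv Thm. 31)] -/
theorem exists_tower_of_forall_exists {T : ℝ} (hT : 0 < T)
    {b : ℝ → EuclideanSpace ℝ (Fin 3) → Fin 3 → ℂ}
    (hB : ∀ n : ℕ, ∃ B : ℕ → ℝ → EuclideanSpace ℝ (Fin 3) → Fin 3 → ℂ, B 0 = b ∧
      ∀ l, IsDomFamily T n (fun k t ξ => B k t ξ l)) :
    ∃ B : ℕ → ℝ → EuclideanSpace ℝ (Fin 3) → Fin 3 → ℂ, B 0 = b ∧
      ∀ n l, IsDomFamily T n (fun k t ξ => B k t ξ l) := by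
  choose Bt hBt0 hBt using hB
  -- the diagonal tower
  refine ⟨fun k => Bt k k, hBt0 0, fun n l => ?_⟩
  -- members `j ≤ k` of the towers of orders `k` and `k'` agree on the slab
  have hagree : ∀ k k' j, j ≤ k → j ≤ k' → ∀ t ∈ Icc 0 T, ∀ ξ,
      Bt k j t ξ l = Bt k' j t ξ l := fun k k' j hj hj' t ht ξ =>
    IsDomFamily.eq_on_of_zero_eq hT (hBt k l) (hBt k' l)
      (by funext t ξ; simp only [hBt0 k, hBt0 k']) j hj hj' t ht ξ
  refine ⟨fun k hk t ht => (hBt k l).meas k le_rfl t ht, fun k hk K => (hBt k l).dom k le_rfl K,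
    fun k hk ξ => (hBt k l).cont k le_rfl ξ, fun k hk ξ t ht => ?_⟩
  -- derivative: `∂ₜ (Bt k k) = Bt (k+1) (k+1)` within the slab, through the tower of order `k+1`
  have hd : HasDerivWithinAt (fun s => Bt (k + 1) k s ξ l) (Bt (k + 1) (k + 1) t ξ l) (Icc 0 T) t :=
    (hBt (k + 1) l).deriv k (by omega) ξ t ht
  have heq : ∀ s ∈ Icc 0 T, Bt (k + 1) k s ξ l = Bt k k s ξ l := fun s hs =>
    hagree (k + 1) k k (by omega) le_rfl s hs ξ
  exact hd.congr (fun s hs => (heq s hs).symm) (heq t ht).symm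

/-- **The package with a per-order tower hypothesis** (the shape a physical-transfer file indexed
by iterated one-sided time derivatives naturally delivers): same conclusion as
`IsSobolevMildForced.classical`. [cite: Tao2011, Thm. 5.4 (iv) (arXiv Thm. 31)] -/
theorem IsSobolevMildForced.classical' {ν T : ℝ} (hν : 0 < ν) (hT : 0 < T)
    {a : EuclideanSpace ℝ (Fin 3) → Fin 3 → ℂ} (ha : IsSobolevFourierDatum a)
    {b : ℝ → EuclideanSpace ℝ (Fin 3) → Fin 3 → ℂ}
    (hB : ∀ n : ℕ, ∃ B : ℕ → ℝ → EuclideanSpace ℝ (Fin 3) → Fin 3 → ℂ, B 0 = b ∧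
      ∀ l, IsDomFamily T n (fun k t ξ => B k t ξ l))
    (hbc : ∀ t ∈ Icc 0 T, ∀ ξ l, b t (-ξ) l = conj (b t ξ l))
    {v : ℝ → EuclideanSpace ℝ (Fin 3) → Fin 3 → ℂ} (hv : IsSobolevMildForced (4 * π ^ 2 * ν) T a b v) :
    ∃ p : ℝ → EuclideanSpace ℝ (Fin 3) → ℝ,
      FluidPDE.IsClassicalNSSolutionOn (Icc 0 T) ν (fun t => synthVel (b t))
        (fun t => synthVel (v t)) p ∧
      HasBoundedSobolevNormsOn (Icc 0 T) (fun t => synthVel (v t)) ∧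
      HasBoundedSobolevNormsOn (Icc 0 T)
        (FluidPDE.timeDerivWithin (Icc 0 T) (fun t => synthVel (v t))) ∧
      (∀ n : ℕ, ∃ C : ℝ≥0, ∀ t ∈ Icc 0 T, ∫⁻ x, ‖iteratedFDeriv ℝ n (p t) x‖ₑ ^ 2 ≤ C) ∧
      FluidPDE.ContinuousInLpOn (Icc 0 T) 2 (fun t => synthVel (v t)) := by
  obtain ⟨B, hB0, hBall⟩ := exists_tower_of_forall_exists hT hB
  exact hv.classical hν hT ha hB0 hBall hbc

/-- **The package for a POINTWISE-DECAYING tower** (`IsFourierFamily`, the shape of the tree's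
`hasDecay_forceData_uniform`): square domination follows (`IsFourierFamily.isDomFamily`).
[cite: Tao2011, Thm. 5.4 (iv) (arXiv Thm. 31)] -/
theorem IsSobolevMildForced.classical_of_isFourierFamily {ν T : ℝ} (hν : 0 < ν) (hT : 0 < T)
    {a : EuclideanSpace ℝ (Fin 3) → Fin 3 → ℂ} (ha : IsSobolevFourierDatum a)
    {b : ℝ → EuclideanSpace ℝ (Fin 3) → Fin 3 → ℂ}
    (hB : ∀ n : ℕ, ∃ B : ℕ → ℝ → EuclideanSpace ℝ (Fin 3) → Fin 3 → ℂ, B 0 = b ∧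
      ∀ l, IsFourierFamily T n (fun k t ξ => B k t ξ l))
    (hbc : ∀ t ∈ Icc 0 T, ∀ ξ l, b t (-ξ) l = conj (b t ξ l))
    {v : ℝ → EuclideanSpace ℝ (Fin 3) → Fin 3 → ℂ} (hv : IsSobolevMildForced (4 * π ^ 2 * ν) T a b v) :
    ∃ p : ℝ → EuclideanSpace ℝ (Fin 3) → ℝ,
      FluidPDE.IsClassicalNSSolutionOn (Icc 0 T) ν (fun t => synthVel (b t))
        (fun t => synthVel (v t)) p ∧
      HasBoundedSobolevNormsOn (Icc 0 T) (fun t => synthVel (v t)) ∧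
      HasBoundedSobolevNormsOn (Icc 0 T)
        (FluidPDE.timeDerivWithin (Icc 0 T) (fun t => synthVel (v t))) ∧
      (∀ n : ℕ, ∃ C : ℝ≥0, ∀ t ∈ Icc 0 T, ∫⁻ x, ‖iteratedFDeriv ℝ n (p t) x‖ₑ ^ 2 ≤ C) ∧
      FluidPDE.ContinuousInLpOn (Icc 0 T) 2 (fun t => synthVel (v t)) :=
  hv.classical' hν hT ha (fun n => by
    obtain ⟨B, hB0, hBn⟩ := hB n
    exact ⟨B, hB0, fun l => (hBn l).isDomFamily⟩) hbc

end Solution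

end FourierNS

end Literature.Analysis.FluidPDE

end
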